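import Literature.MathematicalPhysics.QuantumFieldTheory.Balaban1983to89.B9B8KnitLetterGpDecay
import Literature.MathematicalPhysics.QuantumFieldTheory.Balaban1983to89.B8Ineq159GaugeCovariance
import Literature.MathematicalPhysics.QuantumFieldTheory.Balaban1983to89.B9Eq3104CutoffCommutatorSizes

/-!
# `Balaban1983to89.B9B8KnitLetterCovariance` — [B9] (3.28)–(3.33) AT THE KNIT LETTER `parKnitY`: print's composite-contour transporters transform as
# contour variables, *«R(U^u(Γ^{(j)}_{y,x})) = R(u(y))R(U(Γ^{(j)}_{y,x}))R(u⁻¹(x))»* (p. 395), hence `Δ′_a(U^u) = R(u)Δ′_a(U)R(u⁻¹)` (3.31),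
# `Q′(U^u)R(u) = R(u)Q′(U)` (3.32), `G′(U^u) = R(u)G′(U)R(u⁻¹)`, `R(U^u) = R(u)R(U)R(u⁻¹)` (3.33), and the same for `Q′G′²Q′*`, `C`, `H′`
# (junction J-B file 14 — gauge covariance of every letter of the junction at print's own transporters)

statement-level skeleton of published theorems with citation tags; proofs where landed; nothing here is a claim about the
Yang–Mills mass gap

T. Bałaban, *Propagators for lattice gauge theories in a background field*, Commun. Math. Phys. **99** (1985) 389–434 [`Balaban1985BackgroundPropagators`,
"[B9]"]; T. Bałaban, *Averaging operations for lattice gauge theories*, Commun. Math. Phys. **98** (1985) 17–51 [`Balaban1985Averaging`, "[B7]"];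
T. Bałaban, *Spaces of regular gauge field configurations on a lattice and gauge fixing conditions*, Commun. Math. Phys. **99** (1985) 75–102
[`Balaban1985RegularSpaces`, "[B8]"].

THE PRINT.  [B9] (3.28) p. 395: `U → U^u`, `U′ → R(u)U′`; (3.31) p. 395: `Δ^η_{U^u} = R(u)Δ^η_UR(u⁻¹)`; p. 395: *«The matrices in the definitions (3.19)
transform as follows R(U^u(Γ^{(j)}_{y,x})) = R(u(y))R(U(Γ^{(j)}_{y,x}))R(u⁻¹(x)), hence (Q′_j(U^u)R(u)λ)(y) = R(u(y))(Q′_j(U)λ)(y)»* (3.32);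
p. 396: *«The equalities (3.31), (3.32) imply further G′(U^u) = R(u)G′(U)R(u⁻¹), R(U^u) = R(u)R(U)R(u⁻¹)»* (3.33).  [B7] (11) p. 19, (52)–(53) p. 27:
the composite contours `Γ^{(j)}_{y,x}` and the covariance of the averaged configurations.

WHY THIS FILE ∕ THE ARGUMENT.  def-Y proved (3.30)–(3.34) for every letter built on a transporter table obeying the law `τ(U^u; z, w) = u(z)τ(U; z, w)u(w)⁻¹`
FOR ALL PAIRS (`Node00.OpsYGauge.IsGaugeLawS`, satisfied by the taxicab table `parSymY`).  Print's knit table `parKnitY` (junction file 1) carries the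
composite-contour holonomy only on CORNER PAIRS `(corner of Δ(w), w)` (and its inverse on `(z, corner of Δ(z))`), and `1` elsewhere — so it obeys the law
exactly on the pairs the letters read, which is all def-Y's engine `intw_trLiftY` asks (its hypothesis is the law ON THE SUPPORT OF THE KERNEL).  The law on
corner pairs is [B7]'s covariance of the averaged configurations (`avgIter_gaugeAct_units`) read through [B8]'s block transporters (`bgT_gaugeAct`) and
telescoped along the composite contour (`compT`), with the lifted gauge function `ũ = liftFun u` (`liftCfg (U^u) = (liftCfg U)^ũ`); the top factor is `u`
at the block corner because the corner of `Δ(w)` has coordinates `L^{j(w)}·⌊w/L^{j(w)}⌋`.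

CITATION HEADER (lean-in-tree rule).  Cell `lit-balaban`, sub-row G-B9-LETTERS, junction J-B file 14 → seat `lit-balaban-p33` gen 94.  REUSED BY NAME:
`Node00.{Intw, conjY, gaugeY, gSiteY, gBlkY, intw_trLiftY, lapSL_cov, kernelTrOpY_eq_trLiftY, isUnit_conjY, IsCovSiteOpY, intw_liftMatY_diagonal}` (def-Y
`OpsYGauge`), `B8Ineq159GaugeCovariance.bgT_gaugeAct`, `B7AvgGaugeCovariance.uLev`, `B9B8AveragingJunction.{knitT, parOfT, parKnitY, blockMap_iterate}`,
`B9B8CarrierDictionary.{liftFun, liftCfg}`, `B10Eq27TorusAxialLog.transl_add_e`, `B9B8KnitVsTaxicab.boxEquiv_symm_eq_transl`,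
`B9Thm311DeltaPrimeSymm.{cornerY_eq_of_avgCoeffY_ne_zero, cornerY_levY_eq}`, `B9Thm311PositivityKnitLetter.GpKnitY`,
`B9Eq3104CutoffCommutatorSizes.{qpK_ne_zero_imp, qpsK_ne_zero_imp}` (M5.7, p38).

WHAT THIS FILE PROVES (sorry-free; no definitions; nothing of [B9]'s analysis asserted).
* §1 `liftCfg_gaugeY` (the periodic lift intertwines the gauge actions), ★ `compT_bgT_gaugeAct` (the composite-contour holonomy of [B8]'s block transporters
  transforms as a contour variable — telescoping), `cornerY_val_eq_smul`, ★ `knitT_liftCfg_gaugeY` (`U^u(Γ^{(j)}_{y,w}) = u(y)U(Γ^{(j)}_{y,w})u(w)⁻¹` on the carrier).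
* §2 ★ `parKnitY_gaugeY_of_corner_left` ∕ `_right` (the law on corner pairs), ★ `avgTrY_parKnitY_gaugeY` (the law for the averaging transporter ON THE SUPPORT
  of the coefficient), `qpT_parKnitY_gaugeY` (kernel supports: M5.7's `qpK_ne_zero_imp` ∕ `qpsK_ne_zero_imp` BY NAME).
* §3 ★★ `deltaPrimeAY_parKnitY_cov` (3.31), ★★ `QpY_parKnitY_cov` ∕ `QpsY_parKnitY_cov` (3.32), ★★★ **`GpY_parKnitY_cov`** ∕ `GpY_parKnitY_isCovSiteOpY` ∕
  `GpKnitY_cov` (3.33 for `G′`), `XY_parKnitY_cov`, `XinvY_parKnitY_cov`, ★★ `RY_parKnitY_cov` (3.33 for `R`), `CY_parKnitY_cov`, `Hprime_parKnitY_cov` ([B8] (1.91));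
  pointwise printed forms `deltaPrimeAY_parKnitY_gaugeY_apply`, `GpY_parKnitY_gaugeY_apply`, `RY_parKnitY_gaugeY_apply`.

HONEST SCOPE.  Algebra of finite lattice operators, valid for EVERY invertible gauge function and every background (no smallness, no unitarity);
`parKnitY` is NOT a lawful table in def-Y's everywhere sense (it is `1` off the corner pairs) — the file proves exactly the corner-pair law and feeds
def-Y's support-sensitive engine.  Count-neutral; nothing continuum, nothing about OS axioms or the mass gap.  No `sorry`, no `axiom`, no `instance`, no
`notation`.  NEW file; nothing landed is modified.  Net new unproved facts: 0.  Seat `lit-balaban-p33` gen 94, 2026-08-28.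
-/

noncomputable section

namespace Literature.MathematicalPhysics.QuantumFieldTheory.Balaban1983to89.B9B8KnitLetterCovariance

open Node00 B6KLevelCensusIndexV1 B6GlobalChartV1 B9BackgroundsKLevelV1 B9Eq39Adjoint
open B7Prop1Explicit (gaugeAct)
open B7AvgGaugeCovariance (uLev uLev_apply uLev_zero uLev_smul)
open Literature.MathematicalPhysics.QuantumLattice (blockMap blockBase)
open B4Reflection242 (blk)
open B6Geom246MultiLevelBox (blkOf)
open B8Eq119TwistedAxial (bgT)
open B8Ineq159GaugeCovariance (bgT_gaugeAct)
open B10Eq27TorusAxialLog (transl transl_add_e)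
open B9B8CarrierDictionary (liftFun liftFun_apply liftCfg liftCfg_apply)
open B9B8AveragingKernelZd (compT compT_zero compT_succ)
open B9B8AveragingJunction (knitT parOfT parKnitY blockMap_iterate blk_eq_blockMap)
open B9B8KnitVsTaxicab (boxEquiv_symm_eq_transl)
open B9Thm311DeltaPrimeSymm (cornerY_eq_of_avgCoeffY_ne_zero cornerY_levY_eq)
open B9Thm311PositivityKnitLetter (GpKnitY)
open B9Eq3104CutoffCommutatorSizes (qpK_ne_zero_imp qpsK_ne_zero_imp)
open scoped Matrix

variable {d ℓ : ℕ} {hd : 1 ≤ d + 1} {hL : Odd (ℓ + 1) ∧ 1 < ℓ + 1} {b₀ b₁ : ℝ}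
variable {𝔸 : Type} [NormedRing 𝔸] [NormedAlgebra ℂ 𝔸] [CompleteSpace 𝔸]

/-! ## §1 The composite-contour holonomy transforms as a contour variable -/

section Contour

variable (i : KIdx d ℓ hd hL b₀ b₁)

/-- the periodic lift intertwines the gauge actions: `liftCfg (U^u) = (liftCfg U)^{ũ}` with `ũ = liftFun u`. [cite: Balaban1985BackgroundPropagators, (3.28) p.395; Balaban1985RegularSpaces, (1.17) p.78, bookkeeping] -/
theorem liftCfg_gaugeY (g : GaugeY 𝔸 i) (U : CfgY 𝔸 i) : liftCfg (gaugeY i g U) = gaugeAct (liftFun g) (liftCfg U) := by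
  funext z μ
  rw [liftCfg_apply, gaugeY_apply]
  show _ = liftFun g z * liftCfg U z μ * (liftFun g (z + B7Prop1Explicit.e μ))⁻¹
  rw [liftFun_apply, liftFun_apply, liftCfg_apply, transl_add_e]

/-- ★ **THE COMPOSITE-CONTOUR HOLONOMY OF [B8]'s BLOCK TRANSPORTERS IS A CONTOUR VARIABLE**: `T^{(j)}[V^u](y_j(x), x) = u(Lʲ y_j(x))·T^{(j)}[V](y_j(x), x)·u(x)⁻¹`,
`y_j(x) = ⌊x/Lʲ⌋` (telescoping [B8]'s `bgT_gaugeAct` along [B7]'s composite contour (52)–(53)). [cite: Balaban1985BackgroundPropagators, p.395 («R(U^u(Γ^{(j)}_{y,x})) = R(u(y))R(U(Γ^{(j)}_{y,x}))R(u⁻¹(x))»); Balaban1985Averaging, (11) p.19, (52)–(53) p.27] -/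
theorem compT_bgT_gaugeAct {D : ℕ} (L : ℕ) (u : (Fin D → ℤ) → 𝔸ˣ) (V : (Fin D → ℤ) → Fin D → 𝔸ˣ) :
    ∀ (j : ℕ) (x : Fin D → ℤ), compT L (bgT L (gaugeAct u V)) j ((blockMap L)^[j] x) x
      = uLev L u j ((blockMap L)^[j] x) * compT L (bgT L V) j ((blockMap L)^[j] x) x * (u x)⁻¹
  | 0, x => by rw [compT_zero, compT_zero, Function.iterate_zero, id, uLev_zero, mul_one, mul_inv_cancel]
  | j + 1, x => by
    rw [compT_succ, compT_succ, Function.iterate_succ_apply', bgT_gaugeAct, compT_bgT_gaugeAct L u V j x,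
      B8Eq119TwistedAxial.blockBase_eq_smul, uLev_smul]
    simp only [mul_assoc, inv_mul_cancel_left]

/-- the corner of the level-`j` block of `z`, in coordinates: `Lʲ·⌊z/Lʲ⌋`. [cite: Balaban1985BackgroundPropagators, (3.19) p.393, bookkeeping] -/
theorem cornerY_val_eq_smul (j : ℕ) (z : SiteY i) : (cornerY i j z).1 = (((ℓ + 1 : ℕ) : ℤ) ^ j) • blk ((ℓ + 1) ^ j) z.1 := by
  funext μ
  rw [cornerY_apply, Pi.smul_apply, smul_eq_mul, Nat.cast_pow]

/-- ★ **print's `U(Γ^{(j)}_{y,w})` ON def-Y's CARRIER TRANSFORMS AS A CONTOUR VARIABLE from the block corner to the site**: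
`knitT[U^u](w) = u(c(w))·knitT[U](w)·u(w)⁻¹`, `c(w)` the corner of `Δ(w)`. [cite: Balaban1985BackgroundPropagators, (3.19) p.393, p.395 (before (3.32)); Balaban1985Averaging, (52)–(53) p.27] -/
theorem knitT_liftCfg_gaugeY (g : GaugeY 𝔸 i) (U : CfgY 𝔸 i) (w : SiteY i) :
    knitT i (bgT (ℓ + 1) (liftCfg (gaugeY i g U))) w
      = gSiteY i g (cornerY i (levY i w) w) * knitT i (bgT (ℓ + 1) (liftCfg U)) w * (gSiteY i g w)⁻¹ := by
  have hb : blk ((ℓ + 1) ^ levY i w) w.1 = (blockMap (ℓ + 1))^[levY i w] w.1 := by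
    rw [blockMap_iterate, blk_eq_blockMap]
  unfold knitT
  rw [liftCfg_gaugeY, hb, compT_bgT_gaugeAct, uLev_apply, ← hb]
  have h1 : liftFun g ((((ℓ + 1 : ℕ) : ℤ) ^ levY i w) • blk ((ℓ + 1) ^ levY i w) w.1) = gSiteY i g (cornerY i (levY i w) w) := by
    show _ = g ((boxEquiv i.hN).symm (cornerY i (levY i w) w))
    rw [boxEquiv_symm_eq_transl, cornerY_val_eq_smul, liftFun_apply]
  have h2 : liftFun g w.1 = gSiteY i g w := by
    show _ = g ((boxEquiv i.hN).symm w)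
    rw [boxEquiv_symm_eq_transl, liftFun_apply]
  rw [h1, h2]

end Contour

/-! ## §2 The knit table obeys the transporter law on corner pairs, hence on the support of every kernel that reads it -/

section Table

variable (i : KIdx d ℓ hd hL b₀ b₁) (g : GaugeY 𝔸 i) (U : CfgY 𝔸 i)

/-- ★ the law on a corner pair `(c(w), w)`: `τ_knit(U^u; c(w), w) = u(c(w))·τ_knit(U; c(w), w)·u(w)⁻¹`. [cite: Balaban1985BackgroundPropagators, (3.19) p.393, p.395 (before (3.32))] -/
theorem parKnitY_gaugeY_of_corner_left {z w : SiteY i} (h : cornerY i (levY i w) w = z) :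
    parKnitY i (gaugeY i g U) z w = gSiteY i g z * parKnitY i U z w * (gSiteY i g w)⁻¹ := by
  show parOfT i (bgT (ℓ + 1) (liftCfg (gaugeY i g U))) z w = gSiteY i g z * parOfT i (bgT (ℓ + 1) (liftCfg U)) z w * (gSiteY i g w)⁻¹
  unfold parOfT
  rw [if_pos h, if_pos h, knitT_liftCfg_gaugeY, h]

/-- ★ the law on the reversed pair `(z, c(z))` (the inverse leg of `Q′*`). [cite: Balaban1985BackgroundPropagators, (3.19) p.393, (3.24) p.394, p.395] -/
theorem parKnitY_gaugeY_of_corner_right {z w : SiteY i} (h : cornerY i (levY i z) z = w) :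
    parKnitY i (gaugeY i g U) z w = gSiteY i g z * parKnitY i U z w * (gSiteY i g w)⁻¹ := by
  by_cases h' : cornerY i (levY i w) w = z
  · exact parKnitY_gaugeY_of_corner_left i g U h'
  · show parOfT i (bgT (ℓ + 1) (liftCfg (gaugeY i g U))) z w = gSiteY i g z * parOfT i (bgT (ℓ + 1) (liftCfg U)) z w * (gSiteY i g w)⁻¹
    unfold parOfT
    rw [if_neg h', if_pos h, if_neg h', if_pos h, knitT_liftCfg_gaugeY, h]
    simp only [mul_inv_rev, inv_inv, mul_assoc]

/-- ★ **THE AVERAGING TRANSPORTER OF (3.24) AT THE KNIT LETTER IS A CONTOUR VARIABLE ON THE SUPPORT OF THE COEFFICIENT**: for `w` in the block of `z`,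
`τ(U^u; z, w) = u(z)τ(U; z, w)u(w)⁻¹`. [cite: Balaban1985BackgroundPropagators, (3.19) p.393, (3.24) p.394, (3.28) p.395, p.395 (before (3.32))] -/
theorem avgTrY_parKnitY_gaugeY {z w : SiteY i} (hzw : avgCoeffY i z w ≠ 0) :
    avgTrY i (parKnitY i) (gaugeY i g U) z w = gSiteY i g z * avgTrY i (parKnitY i) U z w * (gSiteY i g w)⁻¹ := by
  have hc : cornerY i (levY i w) w = cornerY i (levY i z) z := cornerY_eq_of_avgCoeffY_ne_zero i hzw
  rw [avgTrY, avgTrY, parKnitY_gaugeY_of_corner_right i g U rfl, parKnitY_gaugeY_of_corner_left i g U hc]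
  simp only [mul_assoc, inv_mul_cancel_left]

/-- the block-averaging transporters of `Q′(U)` at the knit letter transform as `T′(s, z) = u(c_s)T(s, z)u(z)⁻¹` on the block of `s`.
[cite: Balaban1985BackgroundPropagators, (3.19) p.393, (3.32) p.395] -/
theorem qpT_parKnitY_gaugeY {s : BlkY i} {z : SiteY i} (hs : blkOf i.D.toDomains z = s) :
    qpT i (parKnitY i) (gaugeY i g U) s z = gBlkY i g s * qpT i (parKnitY i) U s z * (gSiteY i g z)⁻¹ := by
  subst hs
  show parKnitY i (gaugeY i g U) (blkCornerY i (blkOf i.D.toDomains z)) z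
    = gSiteY i g (blkCornerY i (blkOf i.D.toDomains z)) * parKnitY i U (blkCornerY i (blkOf i.D.toDomains z)) z * (gSiteY i g z)⁻¹
  exact parKnitY_gaugeY_of_corner_left i g U (cornerY_levY_eq i z)

end Table

/-! ## §3 (3.31)–(3.33) at the knit letter: `Δ′_a`, `Q′`, `Q′*`, `G′`, `η²G′`, `Q′G′²Q′*`, `C`, `R`, `H′` -/

section Covariance

variable (i : KIdx d ℓ hd hL b₀ b₁) (g : GaugeY 𝔸 i) (U : CfgY 𝔸 i)

/-- ★★ **(3.31)–(3.32) FOR `Δ′_a(U)` AT THE KNIT LETTER: `Δ′_a(U^u; parKnitY)R(u) = R(u)Δ′_a(U; parKnitY)`** — the covariant Laplacian (def-Y's `lapSL_cov`) plus the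
transported averaging kernel, whose transporters obey the law on the support of the coefficient. [cite: Balaban1985BackgroundPropagators, (3.24) p.394, (3.31)–(3.32) p.395] -/
theorem deltaPrimeAY_parKnitY_cov :
    Intw (conjY (gSiteY i g)) (conjY (gSiteY i g)) (deltaPrimeAY i (parKnitY i) U) (deltaPrimeAY i (parKnitY i) (gaugeY i g U)) := by
  unfold deltaPrimeAY
  refine (lapSL_cov i g U).add ?_
  rw [kernelTrOpY_eq_trLiftY, kernelTrOpY_eq_trLiftY]
  exact intw_trLiftY _ _ _ _ _ fun z w h => avgTrY_parKnitY_gaugeY i g U h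

/-- (3.31) at the knit letter, applied: `Δ′_a(U^u)(R(u)Λ) = R(u)(Δ′_a(U)Λ)`. [cite: Balaban1985BackgroundPropagators, (3.31) p.395] -/
theorem deltaPrimeAY_parKnitY_gaugeY_apply (Λ : SiteY i → 𝔸) :
    deltaPrimeAY i (parKnitY i) (gaugeY i g U) (conjY (gSiteY i g) Λ) = conjY (gSiteY i g) (deltaPrimeAY i (parKnitY i) U Λ) :=
  (deltaPrimeAY_parKnitY_cov i g U).apply Λ

/-- ★★ **(3.32) FOR `Q′(U)` AT THE KNIT LETTER**: `Q′(U^u)R(u)λ = R(u)Q′(U)λ` — *«(Q′_j(U^u)R(u)λ)(y) = R(u(y))(Q′_j(U)λ)(y)»*.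
[cite: Balaban1985BackgroundPropagators, (3.19) p.393, (3.32) p.395] -/
theorem QpY_parKnitY_cov : Intw (conjY (gSiteY i g)) (conjY (gBlkY i g)) (QpY i (parKnitY i) U) (QpY i (parKnitY i) (gaugeY i g U)) :=
  intw_trLiftY _ _ _ _ _ fun _ _ h => qpT_parKnitY_gaugeY i g U (qpK_ne_zero_imp i h)

/-- ★★ (3.32) for `Q′*(U)` at the knit letter. [cite: Balaban1985BackgroundPropagators, (3.24)–(3.25) p.394, (3.32) p.395] -/
theorem QpsY_parKnitY_cov : Intw (conjY (gBlkY i g)) (conjY (gSiteY i g)) (QpsY i (parKnitY i) U) (QpsY i (parKnitY i) (gaugeY i g U)) :=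
  intw_trLiftY _ _ _ _ _ fun _ _ h => by
    rw [qpT_parKnitY_gaugeY i g U (qpsK_ne_zero_imp i h), mul_inv_rev, mul_inv_rev, inv_inv, mul_assoc]

/-- ★★★ **(3.33) FOR `G′(U) = Δ′_a(U)⁻¹` AT THE KNIT LETTER: `G′(U^u; parKnitY)R(u) = R(u)G′(U; parKnitY)`** — *«G′(U^u) = R(u)G′(U)R(u⁻¹)»* at print's own
transporters (conjugate operators have conjugate `Ring.inverse`s; no invertibility hypothesis). [cite: Balaban1985BackgroundPropagators, (3.33) p.396, (3.31)–(3.32) p.395] -/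
theorem GpY_parKnitY_cov : Intw (conjY (gSiteY i g)) (conjY (gSiteY i g)) (GpY i (parKnitY i) U) (GpY i (parKnitY i) (gaugeY i g U)) :=
  (deltaPrimeAY_parKnitY_cov i g U).ringInverse (isUnit_conjY _)

/-- (3.33) at the knit letter, applied: `G′(U^u)(R(u)Λ) = R(u)(G′(U)Λ)`. [cite: Balaban1985BackgroundPropagators, (3.33) p.396] -/
theorem GpY_parKnitY_gaugeY_apply (Λ : SiteY i → 𝔸) :
    GpY i (parKnitY i) (gaugeY i g U) (conjY (gSiteY i g) Λ) = conjY (gSiteY i g) (GpY i (parKnitY i) U Λ) :=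
  (GpY_parKnitY_cov i g U).apply Λ

/-- `G′` at the knit letter is a covariant site letter in def-Y's sense. [cite: Balaban1985BackgroundPropagators, (3.33) p.396] -/
theorem GpY_parKnitY_isCovSiteOpY : IsCovSiteOpY i (GpY i (parKnitY i) (𝔸 := 𝔸)) := fun g U => GpY_parKnitY_cov i g U

/-- (3.33)′ for `(Q′G′²Q′*)(U)` at the knit letter. [cite: Balaban1985BackgroundPropagators, (3.25) p.394, (3.33) p.396] -/
theorem XY_parKnitY_cov :
    Intw (conjY (gBlkY i g)) (conjY (gBlkY i g)) (XY i (parKnitY i) (GpY i (parKnitY i)) U) (XY i (parKnitY i) (GpY i (parKnitY i)) (gaugeY i g U)) :=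
  (QpY_parKnitY_cov i g U).comp ((GpY_parKnitY_cov i g U).comp ((GpY_parKnitY_cov i g U).comp (QpsY_parKnitY_cov i g U)))

/-- (3.33)′ for `C(U) = (Q′G′²Q′*)⁻¹(U)` at the knit letter. [cite: Balaban1985BackgroundPropagators, (3.25) p.394, (3.33) p.396, (3.48) p.398] -/
theorem XinvY_parKnitY_cov :
    Intw (conjY (gBlkY i g)) (conjY (gBlkY i g)) (XinvY i (parKnitY i) (GpY i (parKnitY i)) U)
      (XinvY i (parKnitY i) (GpY i (parKnitY i)) (gaugeY i g U)) :=
  (XY_parKnitY_cov i g U).ringInverse (isUnit_conjY _)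

/-- ★★ **(3.33) FOR THE PROJECTION `R(U)` OF (3.25) AT THE KNIT LETTER: `R(U^u)R(u) = R(u)R(U)`** — *«R(U^u) = R(u)R(U)R(u⁻¹)»*.
[cite: Balaban1985BackgroundPropagators, (3.25) p.394, (3.33) p.396] -/
theorem RY_parKnitY_cov :
    Intw (conjY (gSiteY i g)) (conjY (gSiteY i g)) (RY i (parKnitY i) (GpY i (parKnitY i)) U) (RY i (parKnitY i) (GpY i (parKnitY i)) (gaugeY i g U)) :=
  Intw.id.sub ((GpY_parKnitY_cov i g U).comp ((QpsY_parKnitY_cov i g U).comp ((XinvY_parKnitY_cov i g U).comp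
    ((QpY_parKnitY_cov i g U).comp (GpY_parKnitY_cov i g U)))))

/-- (3.33) for `R` at the knit letter, applied: `R(U^u)(R(u)f) = R(u)(R(U)f)`. [cite: Balaban1985BackgroundPropagators, (3.33) p.396] -/
theorem RY_parKnitY_gaugeY_apply (f : SiteY i → 𝔸) :
    RY i (parKnitY i) (GpY i (parKnitY i)) (gaugeY i g U) (conjY (gSiteY i g) f) = conjY (gSiteY i g) (RY i (parKnitY i) (GpY i (parKnitY i)) U f) :=
  (RY_parKnitY_cov i g U).apply f

/-- (3.33)′ for the letter `C(U)` in print's units (def-Y's `CY`) at the knit letter. [cite: Balaban1985BackgroundPropagators, (3.48) p.398, (3.33) p.396] -/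
theorem CY_parKnitY_cov :
    Intw (conjY (gBlkY i g)) (conjY (gBlkY i g)) (CY i (parKnitY i) (GpY i (parKnitY i)) U) (CY i (parKnitY i) (GpY i (parKnitY i)) (gaugeY i g U)) :=
  (XinvY_parKnitY_cov i g U).comp (intw_liftMatY_diagonal _ _)

/-- (3.33)′ for [B8] (1.91)'s `H′ = G′²Q′*(Q′G′²Q′*)⁻¹` at the knit letter. [cite: Balaban1985RegularSpaces, (1.91) p.91; Balaban1985BackgroundPropagators, (3.33) p.396] -/
theorem Hprime_parKnitY_cov :
    Intw (conjY (gBlkY i g)) (conjY (gSiteY i g))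
      (GpY i (parKnitY i) U ∘ₗ GpY i (parKnitY i) U ∘ₗ QpsY i (parKnitY i) U ∘ₗ XinvY i (parKnitY i) (GpY i (parKnitY i)) U)
      (GpY i (parKnitY i) (gaugeY i g U) ∘ₗ GpY i (parKnitY i) (gaugeY i g U) ∘ₗ QpsY i (parKnitY i) (gaugeY i g U)
        ∘ₗ XinvY i (parKnitY i) (GpY i (parKnitY i)) (gaugeY i g U)) :=
  (GpY_parKnitY_cov i g U).comp ((GpY_parKnitY_cov i g U).comp ((QpsY_parKnitY_cov i g U).comp (XinvY_parKnitY_cov i g U)))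

end Covariance

section Consumer

open scoped Matrix.Norms.L2Operator

variable {N : ℕ} (i : KIdx d ℓ hd hL b₀ b₁) (g : GaugeY (Matrix (Fin N) (Fin N) ℂ) i) (U : CfgY (Matrix (Fin N) (Fin N) ℂ) i)

/-- ★ (3.33) for the consumer's `η²G′(U)` at the knit letter: `GpKnitY η (U^u) R(u) = R(u) GpKnitY η U`. [cite: Balaban1985BackgroundPropagators, (3.33) p.396; Balaban1985RegularSpaces, (1.17) p.78, (1.95) p.92] -/
theorem GpKnitY_cov (η : ℝ) : Intw (conjY (gSiteY i g)) (conjY (gSiteY i g)) (GpKnitY i η U) (GpKnitY i η (gaugeY i g U)) :=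
  (GpY_parKnitY_cov i g U).smul _

/-- (3.33) for `η²G′` at the knit letter, applied. [cite: Balaban1985BackgroundPropagators, (3.33) p.396] -/
theorem GpKnitY_gaugeY_apply (η : ℝ) (Λ : SiteY i → Matrix (Fin N) (Fin N) ℂ) :
    GpKnitY i η (gaugeY i g U) (conjY (gSiteY i g) Λ) = conjY (gSiteY i g) (GpKnitY i η U Λ) :=
  (GpKnitY_cov i g U η).apply Λ

end Consumer

end Literature.MathematicalPhysics.QuantumFieldTheory.Balaban1983to89.B9B8KnitLetterCovariance

end
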